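import Summits.CriticalPhenomena.PercolationContinuityZ3.Theorems.FK.GibbsOneEdgeEnergy
import Summits.CriticalPhenomena.PercolationContinuityZ3.Theorems.FK.InfiniteVolumeConditionalEnergy
import HarnessLib

/-!
# FK-continuity transplant, FO-10 seat B (viii): finite energy of EVERY DLR-sandwich random-cluster measure —
# `FKGibbs d p q P` ⇒ insertion / deletion tolerance, conditional two-sided finite energy, quasi-independence

Cell `fk-continuity` (bschramm), registry row FO-10b; support file of the FK-continuity transplant
(`--supports stmt-CriticalPhenomena-4575`, helper); builds on p205010 (kernel theorem, internal audit signed;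
external expert review pending). No definitions, no named facts, no sorries; standard axioms.

From the one-edge bounds of `GibbsOneEdgeEnergy.lean` (the DLR sandwich of `FKGibbs` on the region `{x, y}`), for
every measure `P` with `FKGibbs d p q P`, `0 ≤ p ≤ 1`, `q > 0`, `π = p/(p + q(1-p))`:

* the INTEGRATED tolerances in exactly row FO-06b's shapes (`InfiniteVolumeFiniteEnergy.lean`), first on local events
  by induction on `F` (`{ω | ω ∪ F ∈ A}` is local with `A`), then on all measurable events by the tree's
  local-to-measurable comparison `mul_real_preimage_le_of_isLocalEvent`:
  `FKGibbs.pow_mul_real_preimage_openEdges_le` (`π^{|F|} · P{ω | ω ∪ F ∈ A} ≤ P(A)`, `F ⊆ E(ℤ^d)` finite),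
  `FKGibbs.pow_mul_real_preimage_sdiff_le` (`(1-p)^{|F|} · P{ω | ω ∖ F ∈ A} ≤ P(A)`, any finite `F`), and the box
  forms `FKGibbs.insertion_tolerant` (the `insertion_tolerant` field of the tree's `IsInsertionTolerantErgodic`,
  input of the Burton–Keane argument) / `FKGibbs.isDeletionTolerant` (the tree's `IsDeletionTolerant`);
* by this row's measure-generic layer (`ConditionalEnergyGeneric.lean`, namespace `….FK.Tolerance`), for `q ≥ 1`,
  `A` measurable determined by an ARBITRARY set `K` of pairs and finite sets `F`, `S` of edges of `ℤ^d` off `K`,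
  `T ⊆ S`, `D` determined by `S`:
  `π^{|F|} P(A) ≤ P(A ∩ {F open}) ≤ p^{|F|} P(A)`, `(1-p)^{|F|} P(A) ≤ P(A ∩ {F closed}) ≤ (1-π)^{|F|} P(A)`
  (`FKGibbs.pow_mul_real_le_real_inter_subset`, `real_inter_subset_le_pow_mul`,
  `pow_mul_real_le_real_inter_forall_notMem`, `real_inter_forall_notMem_le_pow_mul`, one edge `real_inter_mem_le_mul` /
  `real_inter_notMem_le_mul`), the pattern bounds `π^{|T|}(1-p)^{|S∖T|} P(A) ≤ P(A ∩ [T]_S) ≤ p^{|T|}(1-π)^{|S∖T|} P(A)`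
  (`patternLower_mul_real_le`, `real_inter_localCylinder_le`), positivity of every pattern cylinder
  (`localCylinder_pos`), and QUASI-INDEPENDENCE `q^{-|S|} P(A) P(D) ≤ P(A ∩ D) ≤ q^{|S|} P(A) P(D)`
  (`real_inter_le_pow_mul_real_mul_real`, `real_mul_real_le_pow_mul_real_inter`).

Since `IsBoxLimit.fkGibbs` (`InfiniteVolumeDLR.lean`, row FO-06a-2), file (vi) `InfiniteVolumeConditionalEnergy.lean`
is the special case `P = φ^b_{p,q}`; the point here is that consumers typed against the INTERFACE `FKGibbs`
(FO-10a `DomainMarkovToolkit`, FO-11 `SamePContinuationFK`, FO-08's Burton–Keane argument via `insertion_tolerant`)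
get finite energy with no limit argument and no appeal to uniqueness of the infinite-volume measure — the FK
replacement, for every DLR-sandwich measure, of the `q = 1` chain's product identities at the cone sites
(CONE-PERDECL §C #17, #19, #23, #24/#30, #25, #31).

## References

* G. Grimmett, *The Random-Cluster Model*, Springer 2006: Thm. (3.1)(a) eq. (3.4) (p. 38); Lemma (4.13) (p. 71);
  Thm. (4.17)(b) (p. 75); eq. (4.33) (p. 80). [Grimmett2006]
* R. M. Burton, M. Keane, *Density and uniqueness in percolation*, Comm. Math. Phys. 121 (1989) 501–505 (finite
  energy). [BurtonKeane1989]
-/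

noncomputable section

open MeasureTheory Set
open scoped ENNReal

namespace Summit.CriticalPhenomena.PercolationContinuityZ3.Theorems.FK

open Literature.Probability.Percolation Literature.Probability.LatticeModels

variable {d : ℕ}

namespace FKGibbs

variable {p q : ℝ} {P : Measure (BondConfig (Site d))}

/-! ### Integrated tolerances: local events (induction on `F`), then all measurable events -/

/-- One edge, local events: `π · P{ω | ω ∪ {e} ∈ A} ≤ P(A)` (`H = {ω | ω ∪ {e} ∈ A}` is determined by finitely many
pairs other than `e`, and `H ∩ {e open} ⊆ A`). [cite: Grimmett2006, Thm. (4.17)(b) (p. 75); eq. (3.4) (p. 38)] -/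
theorem div_mul_real_preimage_openEdges_singleton_le_of_isLocalEvent (hG : FKGibbs d p q P)
    (hp : p ∈ Set.Icc (0 : ℝ) 1) (hq : 0 < q) {e : Sym2 (Site d)} (heE : e ∈ (zdGraph d).edgeSet)
    {A : Set (BondConfig (Site d))} (hA : IsLocalEvent A) :
    p / (p + q * (1 - p)) * P.real (openEdges {e} ⁻¹' A) ≤ P.real A := by
  classical
  haveI := hG.isProbabilityMeasure
  obtain ⟨J, hJ⟩ := hA.preimage_openEdges {e}
  have hH : DeterminedBy (openEdges {e} ⁻¹' A) ↑(J.erase e) := by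
    rw [Finset.coe_erase, Set.sdiff_eq]
    exact DeterminedBy.inter_index hJ (determinedBy_preimage_openEdges {e} A)
  have h1 := hG.div_mul_real_le_real_inter_mem_of_finset hp hq heE (J.erase e) hH (Finset.notMem_erase e J)
  have h2 : openEdges {e} ⁻¹' A ∩ {ω | e ∈ ω} ⊆ A := by
    rintro ω ⟨hω, he⟩
    have he' : e ∈ ω := he
    rwa [Set.mem_preimage, openEdges, Set.union_eq_self_of_subset_right (Set.singleton_subset_iff.2 he')] at hω
  exact h1.trans (measureReal_mono h2)

/-- One pair, local events: `(1-p) · P{ω | ω ∖ {e} ∈ A} ≤ P(A)`. [cite: Grimmett2006, Thm. (4.17)(b) (p. 75); eq. (3.4) (p. 38)] -/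
theorem sub_mul_real_preimage_sdiff_singleton_le_of_isLocalEvent (hG : FKGibbs d p q P)
    (hp : p ∈ Set.Icc (0 : ℝ) 1) (hq : 0 < q) (e : Sym2 (Site d)) {A : Set (BondConfig (Site d))}
    (hA : IsLocalEvent A) :
    (1 - p) * P.real ((fun ω => ω \ {e}) ⁻¹' A) ≤ P.real A := by
  classical
  haveI := hG.isProbabilityMeasure
  obtain ⟨J, hJ⟩ := isLocalEvent_preimage_sdiff hA {e}
  have hH : DeterminedBy ((fun ω : BondConfig (Site d) => ω \ {e}) ⁻¹' A) ↑(J.erase e) := by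
    rw [Finset.coe_erase, Set.sdiff_eq]
    exact DeterminedBy.inter_index hJ (determinedBy_preimage_closeEdges {e} A)
  have h1 := hG.sub_mul_real_le_real_inter_notMem_of_finset hp hq e (J.erase e) hH (Finset.notMem_erase e J)
  have h2 : (fun ω : BondConfig (Site d) => ω \ {e}) ⁻¹' A ∩ {ω | e ∉ ω} ⊆ A := by
    rintro ω ⟨hω, he⟩
    have he' : e ∉ ω := he
    rwa [Set.mem_preimage, Set.sdiff_singleton_eq_self he'] at hω
  exact h1.trans (measureReal_mono h2)

/-- Finitely many edges, local events: `π^{|F|} · P{ω | ω ∪ F ∈ A} ≤ P(A)` (induction on `F`; `{ω | ω ∪ F ∈ A}` is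
local with `A`). [cite: Grimmett2006, Thm. (4.17)(b) (p. 75); eq. (3.4) (p. 38)] -/
theorem pow_mul_real_preimage_openEdges_le_of_isLocalEvent (hG : FKGibbs d p q P) (hp : p ∈ Set.Icc (0 : ℝ) 1)
    (hq : 0 < q) {F : Finset (Sym2 (Site d))} (hFE : (↑F : Set (Sym2 (Site d))) ⊆ (zdGraph d).edgeSet)
    {A : Set (BondConfig (Site d))} (hA : IsLocalEvent A) :
    (p / (p + q * (1 - p))) ^ F.card * P.real (openEdges ↑F ⁻¹' A) ≤ P.real A := by
  classical
  have hπ0 : 0 ≤ p / (p + q * (1 - p)) :=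
    div_nonneg hp.1 (add_nonneg hp.1 (mul_nonneg hq.le (sub_nonneg.2 hp.2)))
  induction F using Finset.induction_on generalizing A with
  | empty =>
    have h0 : openEdges (↑(∅ : Finset (Sym2 (Site d))) : Set (Sym2 (Site d))) ⁻¹' A = A := by
      ext ω; simp [openEdges]
    rw [h0, Finset.card_empty, pow_zero, one_mul]
  | insert e F heF ih =>
    have hsplit : openEdges (↑(insert e F) : Set (Sym2 (Site d))) ⁻¹' A =
        openEdges {e} ⁻¹' (openEdges (↑F : Set (Sym2 (Site d))) ⁻¹' A) := by
      ext ω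
      simp only [Set.mem_preimage, openEdges, Finset.coe_insert]
      rw [Set.insert_eq, Set.union_assoc]
    have heE : e ∈ (zdGraph d).edgeSet := hFE (Finset.mem_coe.2 (Finset.mem_insert_self e F))
    have hFE' : (↑F : Set (Sym2 (Site d))) ⊆ (zdGraph d).edgeSet :=
      fun f hf => hFE (Finset.mem_coe.2 (Finset.mem_insert_of_mem (Finset.mem_coe.1 hf)))
    have h1 := hG.div_mul_real_preimage_openEdges_singleton_le_of_isLocalEvent hp hq heE (hA.preimage_openEdges ↑F)
    have h2 := ih hFE' hA
    rw [hsplit, Finset.card_insert_of_notMem heF, pow_succ, mul_assoc]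
    exact (mul_le_mul_of_nonneg_left h1 (pow_nonneg hπ0 _)).trans h2

/-- Finitely many pairs, local events: `(1-p)^{|F|} · P{ω | ω ∖ F ∈ A} ≤ P(A)`. [cite: Grimmett2006, Thm. (4.17)(b) (p. 75); eq. (3.4) (p. 38)] -/
theorem pow_mul_real_preimage_sdiff_le_of_isLocalEvent (hG : FKGibbs d p q P) (hp : p ∈ Set.Icc (0 : ℝ) 1)
    (hq : 0 < q) (F : Finset (Sym2 (Site d))) {A : Set (BondConfig (Site d))} (hA : IsLocalEvent A) :
    (1 - p) ^ F.card * P.real ((fun ω => ω \ ↑F) ⁻¹' A) ≤ P.real A := by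
  classical
  have h10 : 0 ≤ 1 - p := sub_nonneg.2 hp.2
  induction F using Finset.induction_on generalizing A with
  | empty =>
    have h0 : (fun ω : BondConfig (Site d) => ω \ ↑(∅ : Finset (Sym2 (Site d)))) ⁻¹' A = A := by
      ext ω; simp
    rw [h0, Finset.card_empty, pow_zero, one_mul]
  | insert e F heF ih =>
    have hsplit : (fun ω : BondConfig (Site d) => ω \ ↑(insert e F)) ⁻¹' A =
        (fun ω : BondConfig (Site d) => ω \ {e}) ⁻¹' ((fun ω : BondConfig (Site d) => ω \ ↑F) ⁻¹' A) := by
      ext ω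
      simp only [Set.mem_preimage, Finset.coe_insert]
      rw [Set.insert_eq, ← Set.sdiff_sdiff]   -- ω \ ({e} ∪ F) = (ω \ {e}) \ F
    have h1 := hG.sub_mul_real_preimage_sdiff_singleton_le_of_isLocalEvent hp hq e (isLocalEvent_preimage_sdiff hA ↑F)
    have h2 := ih hA
    rw [hsplit, Finset.card_insert_of_notMem heF, pow_succ, mul_assoc]
    exact (mul_le_mul_of_nonneg_left h1 (pow_nonneg h10 _)).trans h2

/-- **Insertion tolerance of every `FKGibbs` measure** (Grimmett 2006, (4.33) "finite energy property", integrated):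
for `0 ≤ p ≤ 1`, `q > 0`, a finite set `F` of edges of `ℤ^d` and every measurable event `A`,
`(p/(p+q(1-p)))^{|F|} · P{ω | ω ∪ F ∈ A} ≤ P(A)` — the shape of row FO-06b's `IsBoxLimit.pow_mul_real_preimage_openEdges_le`.
[cite: Grimmett2006, Thm. (4.17)(b) (p. 75) and eq. (4.33) (p. 80); eq. (3.4) (p. 38)] -/
theorem pow_mul_real_preimage_openEdges_le (hG : FKGibbs d p q P) (hp : p ∈ Set.Icc (0 : ℝ) 1) (hq : 0 < q)
    {F : Finset (Sym2 (Site d))} (hFE : (↑F : Set (Sym2 (Site d))) ⊆ (zdGraph d).edgeSet)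
    {A : Set (BondConfig (Site d))} (hA : MeasurableSet A) :
    (p / (p + q * (1 - p))) ^ F.card * P.real (openEdges ↑F ⁻¹' A) ≤ P.real A := by
  haveI := hG.isProbabilityMeasure
  exact mul_real_preimage_le_of_isLocalEvent (measurable_openEdges _)
    (pow_nonneg (div_nonneg hp.1 (add_nonneg hp.1 (mul_nonneg hq.le (sub_nonneg.2 hp.2)))) _)
    (fun A hA => hG.pow_mul_real_preimage_openEdges_le_of_isLocalEvent hp hq hFE hA) hA

/-- **Deletion tolerance of every `FKGibbs` measure**: for `0 ≤ p ≤ 1`, `q > 0`, a finite set `F` of pairs and every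
measurable event `A`, `(1-p)^{|F|} · P{ω | ω ∖ F ∈ A} ≤ P(A)` — the shape of row FO-06b's
`IsBoxLimit.pow_mul_real_preimage_sdiff_le`. [cite: Grimmett2006, Thm. (4.17)(b) (p. 75) and eq. (4.33) (p. 80); eq. (3.4) (p. 38)] -/
theorem pow_mul_real_preimage_sdiff_le (hG : FKGibbs d p q P) (hp : p ∈ Set.Icc (0 : ℝ) 1) (hq : 0 < q)
    (F : Finset (Sym2 (Site d))) {A : Set (BondConfig (Site d))} (hA : MeasurableSet A) :
    (1 - p) ^ F.card * P.real ((fun ω => ω \ ↑F) ⁻¹' A) ≤ P.real A := by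
  haveI := hG.isProbabilityMeasure
  exact mul_real_preimage_le_of_isLocalEvent (measurable_closeEdges _) (pow_nonneg (sub_nonneg.2 hp.2) _)
    (fun A hA => hG.pow_mul_real_preimage_sdiff_le_of_isLocalEvent hp hq F hA) hA

/-- **Box form of insertion tolerance** (the `insertion_tolerant` field of the tree's `IsInsertionTolerantErgodic`,
consumed by the Burton–Keane uniqueness argument): for every `FKGibbs` measure with `0 < p ≤ 1`, `q > 0` and every box
`Λ_N`, `c · P{ω | ω ∪ E(Λ_N) ∈ S} ≤ P(S)` for all measurable `S`, `c = (p/(p+q(1-p)))^{|E(Λ_N)|} > 0`.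
[cite: Grimmett2006, Thm. (4.17)(b) (p. 75) and eq. (4.33) (p. 80)] [cite: BurtonKeane1989, p. 502 (finite energy)] -/
theorem insertion_tolerant (hG : FKGibbs d p q P) (hp : p ∈ Set.Ioc (0 : ℝ) 1) (hq : 0 < q) (N : ℕ) :
    ∃ c : ℝ, 0 < c ∧ ∀ {S : Set (BondConfig (Site d))}, MeasurableSet S →
      c * P.real (openEdges ↑(edgesIn (zdGraph d) (box d N)) ⁻¹' S) ≤ P.real S := by
  have hp' : p ∈ Set.Icc (0 : ℝ) 1 := ⟨hp.1.le, hp.2⟩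
  have hden : 0 < p + q * (1 - p) := by nlinarith [hp.1, hp.2, hq, mul_nonneg hq.le (sub_nonneg.2 hp.2)]
  refine ⟨(p / (p + q * (1 - p))) ^ (edgesIn (zdGraph d) (box d N)).card, pow_pos (div_pos hp.1 hden) _,
    fun hS => ?_⟩
  exact hG.pow_mul_real_preimage_openEdges_le hp' hq (fun _ he => (mem_edgesIn_iff.1 (Finset.mem_coe.1 he)).1) hS

/-- **Box form of deletion tolerance**: every `FKGibbs` measure with `0 ≤ p < 1`, `q > 0` is deletion tolerant in the
sense of the tree's `IsDeletionTolerant` (`c = (1-p)^{|E(Λ_N)|}`). [cite: Grimmett2006, Thm. (4.17)(b) (p. 75) and eq. (4.33) (p. 80)] -/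
theorem isDeletionTolerant (hG : FKGibbs d p q P) (hp : p ∈ Set.Ico (0 : ℝ) 1) (hq : 0 < q) :
    IsDeletionTolerant P := by
  have hp' : p ∈ Set.Icc (0 : ℝ) 1 := ⟨hp.1, hp.2.le⟩
  intro N
  exact ⟨(1 - p) ^ (edgesIn (zdGraph d) (box d N)).card, pow_pos (sub_pos.2 hp.2) _,
    fun S hS => hG.pow_mul_real_preimage_sdiff_le hp' hq _ hS⟩

/-! ### The two tolerances in the shape of the generic layer `FK.Tolerance.*` -/

/-- Insertion tolerance of a `FKGibbs` measure on the edges of `ℤ^d`, hypothesis `hins` of `FK.Tolerance.*`.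
[cite: Grimmett2006, Thm. (4.17)(b) (p. 75); eq. (3.4) (p. 38)] -/
theorem tolerance_union (hG : FKGibbs d p q P) (hp : p ∈ Set.Icc (0 : ℝ) 1) (hq : 0 < q) :
    ∀ (F : Finset (Sym2 (Site d))) (A : Set (BondConfig (Site d))), (↑F : Set (Sym2 (Site d))) ⊆ (zdGraph d).edgeSet →
      MeasurableSet A → (p / (p + q * (1 - p))) ^ F.card * P.real ((fun ω => ω ∪ ↑F) ⁻¹' A) ≤ P.real A :=
  fun _ _ hF hA => hG.pow_mul_real_preimage_openEdges_le hp hq hF hA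

/-- Deletion tolerance of a `FKGibbs` measure, hypothesis `hdel` of `FK.Tolerance.*` (restricted to the edges of `ℤ^d`
to match the shape). [cite: Grimmett2006, Thm. (4.17)(b) (p. 75); eq. (3.4) (p. 38)] -/
theorem tolerance_sdiff (hG : FKGibbs d p q P) (hp : p ∈ Set.Icc (0 : ℝ) 1) (hq : 0 < q) :
    ∀ (F : Finset (Sym2 (Site d))) (A : Set (BondConfig (Site d))), (↑F : Set (Sym2 (Site d))) ⊆ (zdGraph d).edgeSet →
      MeasurableSet A → (1 - p) ^ F.card * P.real ((fun ω => ω \ ↑F) ⁻¹' A) ≤ P.real A :=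
  fun F _ _ hA => hG.pow_mul_real_preimage_sdiff_le hp hq F hA

/-! ### Conditional two-sided finite energy given an event determined off `F` (arbitrary index set `K`) -/

variable {A : Set (BondConfig (Site d))} {K : Set (Sym2 (Site d))}

/-- **`π^{|F|} P(A) ≤ P(A ∩ {F open})`** for every `FKGibbs` measure (`0 ≤ p ≤ 1`, `q ≥ 1`), `A` measurable
determined by a set `K` of pairs, `F` a finite set of edges of `ℤ^d` disjoint from `K`.
[cite: Grimmett2006, Thm. (4.17)(b) (p. 75); eq. (3.4) (p. 38)] -/
theorem pow_mul_real_le_real_inter_subset (hG : FKGibbs d p q P) (hp : p ∈ Set.Icc (0 : ℝ) 1) (hq : 1 ≤ q)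
    (hA : DeterminedBy A K) (hAm : MeasurableSet A) {F : Finset (Sym2 (Site d))}
    (hFE : (↑F : Set (Sym2 (Site d))) ⊆ (zdGraph d).edgeSet) (hKF : ∀ e ∈ F, e ∉ K) :
    (p / (p + q * (1 - p))) ^ F.card * P.real A ≤ P.real (A ∩ {ω | (↑F : Set (Sym2 (Site d))) ⊆ ω}) :=
  Tolerance.pow_mul_real_le_real_inter_subset P (hG.tolerance_union hp (one_pos.trans_le hq)) hA hAm hFE hKF

/-- **`P(A ∩ {F open}) ≤ p^{|F|} P(A)`** for every `FKGibbs` measure. [cite: Grimmett2006, Thm. (4.17)(b) (p. 75); eq. (3.4) (p. 38)] -/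
theorem real_inter_subset_le_pow_mul (hG : FKGibbs d p q P) (hp : p ∈ Set.Icc (0 : ℝ) 1) (hq : 1 ≤ q)
    (hA : DeterminedBy A K) (hAm : MeasurableSet A) {F : Finset (Sym2 (Site d))}
    (hFE : (↑F : Set (Sym2 (Site d))) ⊆ (zdGraph d).edgeSet) (hKF : ∀ e ∈ F, e ∉ K) :
    P.real (A ∩ {ω | (↑F : Set (Sym2 (Site d))) ⊆ ω}) ≤ p ^ F.card * P.real A := by
  haveI := hG.isProbabilityMeasure
  exact Tolerance.real_inter_subset_le_pow_mul P hp.1 (hG.tolerance_sdiff hp (one_pos.trans_le hq)) hA hAm hFE hKF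

/-- **`(1-p)^{|F|} P(A) ≤ P(A ∩ {F closed})`** for every `FKGibbs` measure. [cite: Grimmett2006, Thm. (4.17)(b) (p. 75); eq. (3.4) (p. 38)] -/
theorem pow_mul_real_le_real_inter_forall_notMem (hG : FKGibbs d p q P) (hp : p ∈ Set.Icc (0 : ℝ) 1) (hq : 1 ≤ q)
    (hA : DeterminedBy A K) (hAm : MeasurableSet A) {F : Finset (Sym2 (Site d))}
    (hFE : (↑F : Set (Sym2 (Site d))) ⊆ (zdGraph d).edgeSet) (hKF : ∀ e ∈ F, e ∉ K) :
    (1 - p) ^ F.card * P.real A ≤ P.real (A ∩ {ω | ∀ e ∈ F, e ∉ ω}) :=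
  Tolerance.pow_mul_real_le_real_inter_forall_notMem P (hG.tolerance_sdiff hp (one_pos.trans_le hq)) hA hAm hFE hKF

/-- **`P(A ∩ {F closed}) ≤ (1-π)^{|F|} P(A)`** for every `FKGibbs` measure. [cite: Grimmett2006, Thm. (4.17)(b) (p. 75); eq. (3.4) (p. 38)] -/
theorem real_inter_forall_notMem_le_pow_mul (hG : FKGibbs d p q P) (hp : p ∈ Set.Icc (0 : ℝ) 1) (hq : 1 ≤ q)
    (hA : DeterminedBy A K) (hAm : MeasurableSet A) {F : Finset (Sym2 (Site d))}
    (hFE : (↑F : Set (Sym2 (Site d))) ⊆ (zdGraph d).edgeSet) (hKF : ∀ e ∈ F, e ∉ K) :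
    P.real (A ∩ {ω | ∀ e ∈ F, e ∉ ω}) ≤ (1 - p / (p + q * (1 - p))) ^ F.card * P.real A := by
  haveI := hG.isProbabilityMeasure
  exact Tolerance.real_inter_forall_notMem_le_pow_mul P (div_insertionDenominator_le_one hp hq)
    (hG.tolerance_union hp (one_pos.trans_le hq)) hA hAm hFE hKF

/-- **One edge**: `P(A ∩ {e open}) ≤ p · P(A)` for every `FKGibbs` measure, `A` measurable determined by `K`,
`e ∈ E(ℤ^d) ∖ K`. [cite: Grimmett2006, Thm. (4.17)(b) (p. 75); eq. (3.4) (p. 38)] -/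
theorem real_inter_mem_le_mul (hG : FKGibbs d p q P) (hp : p ∈ Set.Icc (0 : ℝ) 1) (hq : 1 ≤ q)
    (hA : DeterminedBy A K) (hAm : MeasurableSet A) {e : Sym2 (Site d)} (heE : e ∈ (zdGraph d).edgeSet) (heK : e ∉ K) :
    P.real (A ∩ {ω | e ∈ ω}) ≤ p * P.real A := by
  haveI := hG.isProbabilityMeasure
  exact Tolerance.real_inter_mem_le_mul P (hG.tolerance_sdiff hp (one_pos.trans_le hq)) hA hAm heE heK

/-- **One edge**: `P(A ∩ {e closed}) ≤ (1 - π) · P(A)` for every `FKGibbs` measure, `A` measurable determined by `K`,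
`e ∈ E(ℤ^d) ∖ K`. [cite: Grimmett2006, Thm. (4.17)(b) (p. 75); eq. (3.4) (p. 38)] -/
theorem real_inter_notMem_le_mul (hG : FKGibbs d p q P) (hp : p ∈ Set.Icc (0 : ℝ) 1) (hq : 1 ≤ q)
    (hA : DeterminedBy A K) (hAm : MeasurableSet A) {e : Sym2 (Site d)} (heE : e ∈ (zdGraph d).edgeSet) (heK : e ∉ K) :
    P.real (A ∩ {ω | e ∉ ω}) ≤ (1 - p / (p + q * (1 - p))) * P.real A := by
  haveI := hG.isProbabilityMeasure
  exact Tolerance.real_inter_notMem_le_mul P (hG.tolerance_union hp (one_pos.trans_le hq)) hA hAm heE heK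

/-! ### Pattern cylinders -/

/-- **Lower pattern bound** `π^{|T|} (1-p)^{|S∖T|} P(A) ≤ P(A ∩ [T]_S)` for every `FKGibbs` measure, `S` a finite set of
edges of `ℤ^d` disjoint from `K`, `T ⊆ S`. [cite: Grimmett2006, Thm. (4.17)(b) (p. 75); eq. (3.4) (p. 38)] -/
theorem patternLower_mul_real_le (hG : FKGibbs d p q P) (hp : p ∈ Set.Icc (0 : ℝ) 1) (hq : 1 ≤ q)
    (hA : DeterminedBy A K) (hAm : MeasurableSet A) {S T : Finset (Sym2 (Site d))}
    (hSE : (↑S : Set (Sym2 (Site d))) ⊆ (zdGraph d).edgeSet) (hKS : ∀ e ∈ S, e ∉ K) (hT : T ⊆ S) :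
    (p / (p + q * (1 - p))) ^ T.card * (1 - p) ^ (S \ T).card * P.real A ≤
      P.real (A ∩ localCylinder (↑S : Set (Sym2 (Site d))) ↑T) := by
  classical
  convert Tolerance.patternLower_mul_real_le P (div_nonneg hp.1 (insertionDenominator_pos hp hq).le)
    (hG.tolerance_union hp (one_pos.trans_le hq)) (hG.tolerance_sdiff hp (one_pos.trans_le hq)) hA hAm hSE hKS hT

/-- **Upper pattern bound** `P(A ∩ [T]_S) ≤ p^{|T|} (1-π)^{|S∖T|} P(A)` for every `FKGibbs` measure.
[cite: Grimmett2006, Thm. (4.17)(b) (p. 75); eq. (3.4) (p. 38)] -/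
theorem real_inter_localCylinder_le (hG : FKGibbs d p q P) (hp : p ∈ Set.Icc (0 : ℝ) 1) (hq : 1 ≤ q)
    (hA : DeterminedBy A K) (hAm : MeasurableSet A) {S T : Finset (Sym2 (Site d))}
    (hSE : (↑S : Set (Sym2 (Site d))) ⊆ (zdGraph d).edgeSet) (hKS : ∀ e ∈ S, e ∉ K) (hT : T ⊆ S) :
    P.real (A ∩ localCylinder (↑S : Set (Sym2 (Site d))) ↑T) ≤
      p ^ T.card * (1 - p / (p + q * (1 - p))) ^ (S \ T).card * P.real A := by
  haveI := hG.isProbabilityMeasure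
  convert Tolerance.real_inter_localCylinder_le P hp.1 (div_insertionDenominator_le_one hp hq)
    (hG.tolerance_union hp (one_pos.trans_le hq)) (hG.tolerance_sdiff hp (one_pos.trans_le hq)) hA hAm hSE hKS hT

/-- **Every pattern cylinder is charged**: for a `FKGibbs` measure with `0 < p < 1`, `q ≥ 1`, a finite set `S` of edges
of `ℤ^d` and `T ⊆ S`, `P([T]_S) ≥ π^{|T|}(1-p)^{|S∖T|} > 0` — the FK form of the `q = 1` chain's positivity of
cylinders (`prodBernoulli_real_setOf_forall_iff`). [cite: Grimmett2006, Thm. (4.17)(b) (p. 75); eq. (3.4) (p. 38)] -/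
theorem localCylinder_pos (hG : FKGibbs d p q P) (hp : p ∈ Set.Ioo (0 : ℝ) 1) (hq : 1 ≤ q)
    {S T : Finset (Sym2 (Site d))} (hSE : (↑S : Set (Sym2 (Site d))) ⊆ (zdGraph d).edgeSet) (hT : T ⊆ S) :
    0 < P.real (localCylinder (↑S : Set (Sym2 (Site d))) ↑T) := by
  haveI := hG.isProbabilityMeasure
  have hp' : p ∈ Set.Icc (0 : ℝ) 1 := ⟨hp.1.le, hp.2.le⟩
  have h := hG.patternLower_mul_real_le hp' hq (determinedBy_univ (∅ : Set (Sym2 (Site d)))) MeasurableSet.univ hSE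
    (fun _ _ h => h) hT
  rw [probReal_univ, mul_one, Set.univ_inter] at h
  exact lt_of_lt_of_le (mul_pos (pow_pos (div_pos hp.1 (insertionDenominator_pos hp' hq)) _)
    (pow_pos (sub_pos.2 hp.2) _)) h

/-! ### Quasi-independence of events on and off a finite set of edges -/

/-- **Quasi-independence for every `FKGibbs` measure, upper half**: `A` measurable determined by `K`, `S` a finite set
of edges of `ℤ^d` disjoint from `K`, `D` determined by `S`: `P(A ∩ D) ≤ q^{|S|} · P(A) P(D)` — the FK form, for every
DLR-sandwich measure, of the `q = 1` chain's `P_p(A ∩ D) = P_p(A) P_p(D)`. [cite: Grimmett2006, Thm. (4.17)(b) (p. 75); eq. (3.4) (p. 38)] -/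
theorem real_inter_le_pow_mul_real_mul_real (hG : FKGibbs d p q P) (hp : p ∈ Set.Icc (0 : ℝ) 1) (hq : 1 ≤ q)
    (hA : DeterminedBy A K) (hAm : MeasurableSet A) {S : Finset (Sym2 (Site d))}
    (hSE : (↑S : Set (Sym2 (Site d))) ⊆ (zdGraph d).edgeSet) (hKS : ∀ e ∈ S, e ∉ K) {D : Set (BondConfig (Site d))}
    (hD : DeterminedBy D (↑S : Set (Sym2 (Site d)))) :
    P.real (A ∩ D) ≤ q ^ S.card * (P.real A * P.real D) := by
  haveI := hG.isProbabilityMeasure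
  exact Tolerance.real_inter_le_pow_mul_real_mul_real P (zero_le_one.trans hq)
    (div_nonneg hp.1 (insertionDenominator_pos hp hq).le) (div_insertionDenominator_le_one hp hq) hp.1
    (le_mul_div_insertionDenominator hp hq) (one_sub_div_insertionDenominator_le_mul hp hq)
    (hG.tolerance_union hp (one_pos.trans_le hq)) (hG.tolerance_sdiff hp (one_pos.trans_le hq)) hA hAm hSE hKS hD

/-- **Quasi-independence for every `FKGibbs` measure, lower half**: `P(A) P(D) ≤ q^{|S|} · P(A ∩ D)`.
[cite: Grimmett2006, Thm. (4.17)(b) (p. 75); eq. (3.4) (p. 38)] -/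
theorem real_mul_real_le_pow_mul_real_inter (hG : FKGibbs d p q P) (hp : p ∈ Set.Icc (0 : ℝ) 1) (hq : 1 ≤ q)
    (hA : DeterminedBy A K) (hAm : MeasurableSet A) {S : Finset (Sym2 (Site d))}
    (hSE : (↑S : Set (Sym2 (Site d))) ⊆ (zdGraph d).edgeSet) (hKS : ∀ e ∈ S, e ∉ K) {D : Set (BondConfig (Site d))}
    (hD : DeterminedBy D (↑S : Set (Sym2 (Site d)))) :
    P.real A * P.real D ≤ q ^ S.card * P.real (A ∩ D) := by
  haveI := hG.isProbabilityMeasure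
  exact Tolerance.real_mul_real_le_pow_mul_real_inter P (zero_le_one.trans hq)
    (div_nonneg hp.1 (insertionDenominator_pos hp hq).le) (div_insertionDenominator_le_one hp hq) hp.1
    (le_mul_div_insertionDenominator hp hq) (one_sub_div_insertionDenominator_le_mul hp hq)
    (hG.tolerance_union hp (one_pos.trans_le hq)) (hG.tolerance_sdiff hp (one_pos.trans_le hq)) hA hAm hSE hKS hD

end FKGibbs

end Summit.CriticalPhenomena.PercolationContinuityZ3.Theorems.FK

end
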